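import Summits.HubbardSuperconductivity.HubbardSuperconductivity.Theses.AposterioriCapRg
import Literature.Barriers.HubbardSuperconductivity.PureModelStripeCompetitionProofs
import Literature.MathematicalPhysics.QuantumLattice.HubbardWave0Proofs

/-!
# Crux `SsbToEvenTorusLro` (item `stmt-HubbardSuperconductivity-1315`): the matrix clauses are
load-bearing, the even-side tailoring is immaterial, and the route consumes only the box

Support file of the standing disprover (generation 1; workfile
`Cruxes/SsbToEvenTorusLro/Disproof.lean`). No definition is introduced: the atoms are spelled out — density
matching `Tendsto (L ↦ Re ω₀(N̂)/(L+1)²) atTop (𝓝 (1-δ))` for the tracial grand-canonical ground state of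
`hubbardTorusWith 2 (L+1) 1 U μ`, the Koma–Tasaki order parameter (`HasDWaveOrder U μ`), and the summit matrix
`HasDWavePairFieldLROAt U δ` (by `Iff.rfl` the conclusion the route file inlines). Proved:

* `not_matrix_without_groundStateClause`, `not_matrix_without_normalisation`,
  `not_matrix_without_numberClause` — each of the three admissibility clauses of the summit matrix
  (sector ground state; `star ψ ⬝ᵥ ψ = 1`; `N_L = 2⌊(1-δ)L²/2⌋`) is load-bearing UNCONDITIONALLY: with any one
  of them dropped the matrix is false at every coupling (witnesses: the normalised vacuum sequence; sector
  ground states scaled by `((L+1)√(1+|avg_L|))⁻¹`; normalised ground states of the empty sector `(0,0)`).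
* `hasDWavePairFieldLROAt_of_allSides` — the ALL-sides matrix (the shape of the predecessor stmt-0157) implies
  the even-side matrix for `δ ≥ -1` (re-fill odd sides with normalised sector ground states, which exist on every
  torus): the even-`L` tailoring of this item carries no content (cf. the tree's
  `Theorems.hasDWavePairFieldLROAt_of_forall_hasPairFieldLRO`, the variant with LRO along ALL sides in the hypothesis).
* `ssbToEvenTorusLro_imp_boxTransfer` — the crux implies the BOX transfer (`U ∈ [2,3]`, `δ ∈ [1/5, 7/20]`), which
  is all the route's glue `closes : FixedPointDWaveOrder → SsbToEvenTorusLro → HubbardSuperconductivity` consumes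
  (the five-line glue from the box transfer is kept in the workfile because it concludes the summit);
  `boxTransfer_consistent_with_not_allForm` — abstractly, the box transfer is consistent with failure of the
  crux's `∀ U > 0, ∀ δ ∈ (0,1)` form: a refutation outside the box would be a misstatement for this route.
* `not_ssbToEvenTorusLro_imp` — the armour: a disproof exhibits density-matched Koma–Tasaki d-wave order at some
  `U > 0` together with an order-poor admissible ground-state sequence.

Sources: Koma–Tasaki, J. Stat. Phys. 76 (1994) 745 (order parameter, Conjecture 10); Scalapino, Phys. Rep. 250
(1995) 329 §2 (pair field); Lieb, PRL 62 (1989) 1201 (sectors). All statements are elementary bookkeeping.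
-/

noncomputable section

namespace Summit.HubbardSuperconductivity.HubbardSuperconductivity.Theorems.SsbToEvenTorusLro.Negative

open Literature.MathematicalPhysics.QuantumLattice Literature.Barriers.HubbardSuperconductivity
open Literature.Probability.LatticeModels
open Filter Set Matrix
open scoped ComplexOrder
open _root_.Topology
open Summit.HubbardSuperconductivity.HubbardSuperconductivity.Theses.AposterioriCapRg (SsbToEvenTorusLro)

/-! ### 1. Vacuum and scaling lemmas -/

/-- The vacuum is a unit vector. [folklore] -/
theorem star_vacuum_dotProduct_vacuum {ι : Type*} [LinearOrder ι] [Fintype ι] :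
    star (vacuum : Fock ι) ⬝ᵥ vacuum = 1 := by
  simp [vacuum, dotProduct_single]

/-- Every local pair operator annihilates the vacuum (it ends in an annihilation operator). [folklore] -/
theorem localPair_mulVec_vacuum (g : Site 2 → ℝ) (L : ℕ) [NeZero L] (x : TorusSite 2 L) :
    localPair g L x *ᵥ (vacuum : Fock (Orb (FermionTorus 2 L))) = 0 := by
  have han : ∀ (A : Matrix (Finset (Orb (FermionTorus 2 L))) (Finset (Orb (FermionTorus 2 L))) ℂ)
      (i : Orb (FermionTorus 2 L)), (A * annihilation i) *ᵥ (vacuum : Fock (Orb (FermionTorus 2 L))) = 0 :=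
    fun A i => by rw [← mulVec_mulVec, annihilation_mulVec_vacuum_holds, mulVec_zero]
  simp only [localPair, sum_mulVec, smul_mulVec, sub_mulVec, han, sub_zero, smul_zero,
    Finset.sum_const_zero]

/-- The pair correlations of the constant vacuum sequence vanish identically. [folklore] -/
theorem pairFieldCorr_vacuum (g : Site 2 → ℝ) (L : ℕ) (x y : TorusSite 2 L) :
    pairFieldCorr g (fun _ => vacuum) L x y = 0 := by
  cases L with
  | zero => rfl
  | succ L =>
    rw [pairFieldCorr_succ, expect, ← mulVec_mulVec]
    simp [localPair_mulVec_vacuum]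

/-- `Re⟨cφ, A cφ⟩ = ‖c‖² Re⟨φ, Aφ⟩`. [folklore] -/
theorem re_expect_smul {L : ℕ} (A : Matrix (Finset (Orb (FermionTorus 2 L))) (Finset (Orb (FermionTorus 2 L))) ℂ)
    (c : ℂ) (φ : Fock (Orb (FermionTorus 2 L))) :
    (expect A (c • φ)).re = ‖c‖ ^ 2 * (expect A φ).re := by
  have h : expect A (c • φ) = (starRingEnd ℂ c * c) * expect A φ := by
    rw [expect, expect, Matrix.mulVec_smul, star_smul, smul_dotProduct, dotProduct_smul, smul_eq_mul,
      smul_eq_mul, ← mul_assoc, Complex.star_def]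
  rw [h, Complex.conj_mul', ← Complex.ofReal_pow, Complex.re_ofReal_mul]

/-- Pair correlations are quadratic in the state: scaling `ψ L` by `c L` scales them by `‖c L‖²`. [folklore] -/
theorem pairFieldCorr_smul (g : Site 2 → ℝ) (c : ℕ → ℂ) (ψ : ∀ L, Fock (Orb (FermionTorus 2 L)))
    (L : ℕ) (x y : TorusSite 2 L) :
    pairFieldCorr g (fun L => c L • ψ L) L x y = ‖c L‖ ^ 2 * pairFieldCorr g ψ L x y := by
  cases L with
  | zero => simp [pairFieldCorr]
  | succ L => rw [pairFieldCorr_succ, pairFieldCorr_succ, re_expect_smul]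

/-- A zero-particle Fock vector is a multiple of the vacuum. [folklore] -/
theorem eq_smul_vacuum_of_isNParticle_zero {ι : Type*} [LinearOrder ι] {φ : Fock ι} (h : IsNParticle 0 φ) :
    φ = φ ∅ • (vacuum : Fock ι) := by
  funext s
  by_cases hs : s = ∅
  · subst hs; simp [vacuum]
  · have : φ s = 0 := h s (by rwa [ne_eq, Finset.card_eq_zero])
    simp [vacuum, hs, this]

/-! ### 2. The three admissibility clauses of the summit matrix are load-bearing (unconditionally) -/

/-- **Without the sector-ground-state clause the matrix is false at every doping**: the normalised vacuum
sequence is admissible and its `d`-wave pair correlations vanish identically. [folklore] -/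
theorem not_matrix_without_groundStateClause (δ : ℝ) :
    ¬ ∀ (N : ℕ → ℕ) (ψ : ∀ L, Fock (Orb (FermionTorus 2 L))),
        (∀ L, Even L → N L = 2 * ⌊(1 - δ) * (L : ℝ) ^ 2 / 2⌋₊ ∧ star (ψ L) ⬝ᵥ ψ L = 1) →
          HasLongRangeOrder (fun k => halfOpenBox 2 (2 * k))
            (fun k => torusPullback (pairFieldCorr dWaveFormFactor ψ) (2 * k)) := by
  intro h
  have hl := h (fun L => 2 * ⌊(1 - δ) * (L : ℝ) ^ 2 / 2⌋₊) (fun _ => vacuum)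
    (fun L _ => ⟨rfl, star_vacuum_dotProduct_vacuum⟩)
  unfold HasLongRangeOrder at hl
  simp only [torusPullback_apply, pairFieldCorr_vacuum, Finset.sum_const_zero, zero_div,
    liminf_const] at hl
  exact lt_irrefl _ hl

/-- **Without the normalisation clause the matrix is false** at every `U` and every `δ ≥ -1`: normalised sector
ground states exist on every torus (`hasDWavePairFieldLROAt_admissible_nonempty`); scaled by
`((L+1)√(1+|avg_L|))⁻¹` they remain sector ground states while their box averages are at most `(L+1)⁻²` in
absolute value, so the `liminf` is `0`. [folklore] -/
theorem not_matrix_without_normalisation (U : ℝ) {δ : ℝ} (hδ : -1 ≤ δ) :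
    ¬ ∀ (N : ℕ → ℕ) (ψ : ∀ L, Fock (Orb (FermionTorus 2 L))),
        (∀ L, Even L → N L = 2 * ⌊(1 - δ) * (L : ℝ) ^ 2 / 2⌋₊ ∧
            IsGroundStateInSector (hubbardTorus 2 L 1 U) (N L) 0 (ψ L)) →
          HasLongRangeOrder (fun k => halfOpenBox 2 (2 * k))
            (fun k => torusPullback (pairFieldCorr dWaveFormFactor ψ) (2 * k)) := by
  intro h
  obtain ⟨N, ψ, hadm⟩ := hasDWavePairFieldLROAt_admissible_nonempty U hδ
  set A : (∀ L, Fock (Orb (FermionTorus 2 L))) → ℕ → ℝ := fun φ L =>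
    (∑ x ∈ halfOpenBox 2 L, ∑ y ∈ halfOpenBox 2 L, torusPullback (pairFieldCorr dWaveFormFactor φ) L x y) /
      ((halfOpenBox 2 L).card : ℝ) ^ 2 with hA
  set r : ℕ → ℝ := fun L => 1 / (((L : ℝ) + 1) * Real.sqrt (1 + |A ψ L|)) with hr
  have hrpos : ∀ L, 0 < r L := fun L => by
    have : 0 < Real.sqrt (1 + |A ψ L|) := Real.sqrt_pos.2 (by positivity)
    positivity
  set c : ℕ → ℂ := fun L => ((r L : ℝ) : ℂ) with hc
  have hcne : ∀ L, c L ≠ 0 := fun L => by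
    simp only [hc, ne_eq, Complex.ofReal_eq_zero]; exact (hrpos L).ne'
  have hnorm : ∀ L, ‖c L‖ ^ 2 = 1 / (((L : ℝ) + 1) ^ 2 * (1 + |A ψ L|)) := fun L => by
    have hs : 0 ≤ 1 + |A ψ L| := by positivity
    have h1 : ‖c L‖ = r L := by
      simp only [hc, Complex.norm_real, Real.norm_eq_abs]
      exact abs_of_pos (hrpos L)
    rw [h1, hr]
    show (1 / (((L : ℝ) + 1) * Real.sqrt (1 + |A ψ L|))) ^ 2 = _
    rw [div_pow, one_pow, mul_pow, Real.sq_sqrt hs]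
  have hscale : ∀ L, A (fun L => c L • ψ L) L = ‖c L‖ ^ 2 * A ψ L := fun L => by
    simp only [hA, torusPullback_apply, pairFieldCorr_smul, ← Finset.mul_sum]
    ring
  have hl := h N (fun L => c L • ψ L) fun L _ => ⟨(hadm L).1, isGroundStateInSector_smul (hadm L).2.2 (hcne L)⟩
  change 0 < liminf (fun k => A (fun L => c L • ψ L) (2 * k)) atTop at hl
  have hbound : ∀ k : ℕ, ‖A (fun L => c L • ψ L) (2 * k)‖ ≤ 1 / ((k : ℝ) + 1) := fun k => by
    rw [hscale, hnorm, Real.norm_eq_abs, abs_mul, abs_of_nonneg (by positivity), div_mul_eq_mul_div, one_mul]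
    have hA0 : 0 ≤ |A ψ (2 * k)| := abs_nonneg _
    have hk : (0 : ℝ) ≤ k := Nat.cast_nonneg k
    rw [div_le_div_iff₀ (by positivity) (by positivity)]
    push_cast
    nlinarith [mul_nonneg hk hA0, mul_nonneg (mul_nonneg hk hk) hA0]
  have ht : Tendsto (fun k => A (fun L => c L • ψ L) (2 * k)) atTop (𝓝 0) :=
    squeeze_zero_norm hbound tendsto_one_div_add_atTop_nhds_zero_nat
  rw [ht.liminf_eq] at hl
  exact lt_irrefl _ hl

/-- **Without the particle-number clause the matrix is false** at every `U`: with `N` free, the normalised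
ground states of the EMPTY sector `(N, S^z) = (0, 0)` — multiples of the vacuum, which exist on every torus
(`exists_unit_isGroundStateInSector_hubbardTorus`) — are admissible and have identically vanishing pair
correlations. [folklore] -/
theorem not_matrix_without_numberClause (U : ℝ) :
    ¬ ∀ (N : ℕ → ℕ) (ψ : ∀ L, Fock (Orb (FermionTorus 2 L))),
        (∀ L, Even L → star (ψ L) ⬝ᵥ ψ L = 1 ∧ IsGroundStateInSector (hubbardTorus 2 L 1 U) (N L) 0 (ψ L)) →
          HasLongRangeOrder (fun k => halfOpenBox 2 (2 * k))
            (fun k => torusPullback (pairFieldCorr dWaveFormFactor ψ) (2 * k)) := by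
  intro h
  have key : ∀ L : ℕ, ∃ φ : Fock (Orb (FermionTorus 2 L)), star φ ⬝ᵥ φ = 1 ∧
      IsGroundStateInSector (hubbardTorus 2 L 1 U) (2 * 0) 0 φ :=
    fun L => exists_unit_isGroundStateInSector_hubbardTorus U L 0 (Nat.zero_le _)
  choose φ hφ using key
  have hvac : ∀ L, φ L = φ L ∅ • (vacuum : Fock (Orb (FermionTorus 2 L))) := fun L =>
    eq_smul_vacuum_of_isNParticle_zero ((mem_szSector_iff _ _ _).1 (hφ L).2.1).1
  have hl := h (fun _ => 0) φ fun L _ => ⟨(hφ L).1, by simpa using (hφ L).2⟩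
  have hzero : ∀ (k : ℕ) (x y : TorusSite 2 (2 * k)), pairFieldCorr dWaveFormFactor φ (2 * k) x y = 0 := by
    intro k x y
    have e : φ = fun L => (φ L ∅) • (fun _ => (vacuum : Fock (Orb (FermionTorus 2 _)))) L :=
      funext fun L => hvac L
    rw [e, pairFieldCorr_smul, pairFieldCorr_vacuum, mul_zero]
  unfold HasLongRangeOrder at hl
  simp only [torusPullback_apply, hzero, Finset.sum_const_zero, zero_div, liminf_const] at hl
  exact lt_irrefl _ hl

/-! ### 3. Even sides versus all sides -/

/-- **The all-sides matrix implies the even-side matrix** (`δ ≥ -1`): an even-admissible sequence can be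
re-filled at odd sides by normalised sector ground states, which exist on every torus, without changing any
term of the conclusion. (The converse is trivial: constraining odd sides only shrinks the family.) [folklore] -/
theorem hasDWavePairFieldLROAt_of_allSides {U δ : ℝ} (hδ : -1 ≤ δ)
    (h : ∀ (N : ℕ → ℕ) (ψ : ∀ L, Fock (Orb (FermionTorus 2 L))),
      (∀ L, N L = 2 * ⌊(1 - δ) * (L : ℝ) ^ 2 / 2⌋₊ ∧ star (ψ L) ⬝ᵥ ψ L = 1 ∧
          IsGroundStateInSector (hubbardTorus 2 L 1 U) (N L) 0 (ψ L)) →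
        HasLongRangeOrder (fun k => halfOpenBox 2 (2 * k))
          (fun k => torusPullback (pairFieldCorr dWaveFormFactor ψ) (2 * k))) :
    HasDWavePairFieldLROAt U δ := by
  intro N ψ hψ
  obtain ⟨N', φ, hφ⟩ := hasDWavePairFieldLROAt_admissible_nonempty U hδ
  classical
  let ψ'' : ∀ L, Fock (Orb (FermionTorus 2 L)) := fun L => if Even L then ψ L else φ L
  have hadm : ∀ L, N' L = 2 * ⌊(1 - δ) * (L : ℝ) ^ 2 / 2⌋₊ ∧ star (ψ'' L) ⬝ᵥ ψ'' L = 1 ∧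
      IsGroundStateInSector (hubbardTorus 2 L 1 U) (N' L) 0 (ψ'' L) := by
    intro L
    by_cases hL : Even L
    · obtain ⟨hN, hn, hg⟩ := hψ L hL
      refine ⟨(hφ L).1, ?_, ?_⟩
      · simp only [ψ'', if_pos hL]; exact hn
      · simp only [ψ'', if_pos hL]; rw [(hφ L).1, ← hN]; exact hg
    · refine ⟨(hφ L).1, ?_, ?_⟩
      · simp only [ψ'', if_neg hL]; exact (hφ L).2.1
      · simp only [ψ'', if_neg hL]; exact (hφ L).2.2
  have hl := h N' ψ'' hadm
  have heq : (fun k => torusPullback (pairFieldCorr dWaveFormFactor ψ'') (2 * k)) =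
      fun k => torusPullback (pairFieldCorr dWaveFormFactor ψ) (2 * k) := by
    funext k x y
    have hk : ψ'' (2 * k) = ψ (2 * k) := by simp only [ψ'', if_pos (even_two_mul k)]
    -- `pairFieldCorr g φ L` depends on `φ` only through `φ L` (tree: `Theorems.pairFieldCorr_congr`)
    have hc : ∀ (L : ℕ) (φ φ' : ∀ L, Fock (Orb (FermionTorus 2 L))), φ L = φ' L →
        pairFieldCorr dWaveFormFactor φ L = pairFieldCorr dWaveFormFactor φ' L := by
      intro L φ φ' hL
      cases L with
      | zero => rfl
      | succ L => funext a b; rw [pairFieldCorr_succ, pairFieldCorr_succ, hL]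
    simp only [torusPullback_apply, hc (2 * k) ψ'' ψ hk]
  rwa [heq] at hl

/-! ### 4. The route consumes only the box; abstract independence; the armour -/

/-- **The crux implies the box transfer** (`U ∈ [2,3]`, `δ ∈ [1/5, 7/20]`, the target `FixedPointDWaveOrder`'s
box) — all that the route's deciding theorem consumes. [folklore] -/
theorem ssbToEvenTorusLro_imp_boxTransfer (h : SsbToEvenTorusLro) :
    ∀ U ∈ Icc (2:ℝ) 3, ∀ δ ∈ Icc (1/5:ℝ) (7/20), ∀ μ : ℝ,
      Tendsto (fun L : ℕ => ((hubbardTorusWith 2 (L + 1) 1 U μ).groundStateFunctional totalNumber).re /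
          ((L + 1 : ℕ) : ℝ) ^ 2) atTop (𝓝 (1 - δ)) →
        HasDWaveOrder U μ → HasDWavePairFieldLROAt U δ :=
  fun U hU δ hδ μ hd ho => h U δ μ (by linarith [hU.1]) ⟨by linarith [hδ.1], by linarith [hδ.2]⟩ hd ho

/-- **Abstract independence.** For SOME interpretation of the three atoms (density matching, order parameter
valued in `[0, 4√2]` as in the tree, matrix) the box transfer holds while the all-`(U, δ)` form fails (witness:
matrix `:= U ≤ 3`, failing at `U = 8`): a refutation of the crux outside the box is a misstatement for this
route, repaired by the box transfer. [folklore] -/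
theorem boxTransfer_consistent_with_not_allForm :
    ∃ (D : ℝ → ℝ → ℝ → Prop) (m : ℝ → ℝ → ℝ) (M : ℝ → ℝ → Prop),
      (∀ U μ, 0 ≤ m U μ ∧ m U μ ≤ 4 * Real.sqrt 2) ∧
        (∀ U ∈ Icc (2:ℝ) 3, ∀ δ ∈ Icc (1/5:ℝ) (7/20), ∀ μ : ℝ, D U δ μ → 0 < m U μ → M U δ) ∧
          ¬ (∀ U δ μ : ℝ, 0 < U → δ ∈ Ioo (0:ℝ) 1 → D U δ μ → 0 < m U μ → M U δ) := by
  refine ⟨fun _ _ _ => True, fun _ _ => 1, fun U _ => U ≤ 3, fun _ _ => ⟨zero_le_one, ?_⟩,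
    fun U hU δ _ μ _ _ => hU.2, fun h => ?_⟩
  · have : (1:ℝ) ≤ Real.sqrt 2 := Real.one_le_sqrt.2 (by norm_num)
    linarith
  · have := h 8 (1 / 8) 0 (by norm_num) ⟨by norm_num, by norm_num⟩ trivial one_pos
    norm_num at this

/-- **The armour.** A disproof of the crux exhibits a repulsive coupling, a doping in `(0,1)` and a chemical
potential with grand-canonical density matching AND Koma–Tasaki `d`-wave order, together with failure of the
summit matrix there (an order-poor admissible ground-state sequence). [folklore] -/
theorem not_ssbToEvenTorusLro_imp (h : ¬ SsbToEvenTorusLro) :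
    ∃ U δ μ : ℝ, 0 < U ∧ δ ∈ Ioo (0:ℝ) 1 ∧
      Tendsto (fun L : ℕ => ((hubbardTorusWith 2 (L + 1) 1 U μ).groundStateFunctional totalNumber).re /
          ((L + 1 : ℕ) : ℝ) ^ 2) atTop (𝓝 (1 - δ)) ∧
        HasDWaveOrder U μ ∧ ¬ HasDWavePairFieldLROAt U δ := by
  by_contra hc
  apply h
  intro U δ μ hU hδ hd ho
  by_contra hm
  exact hc ⟨U, δ, μ, hU, hδ, hd, ho, hm⟩

end Summit.HubbardSuperconductivity.HubbardSuperconductivity.Theorems.SsbToEvenTorusLro.Negative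

end
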